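import Literature.MathematicalPhysics.QuantumManyBody.PeriodicBoseGasFourier
import HarnessLib

/-!
# Route `BECConjugateDomination`, glue `IMUChainGlue` (stmt-AtomisticToContinuum-11790) —
# helper I: the eight corners of the cell

For a function `f` on `ℝ³` supported in the ball `‖x‖ < b` with `b ≤ L`, the sum over the eight
corners `Lε`, `ε ∈ {0,1}³`, of the cell integrals of the translates `f(· − Lε)` is the whole-space
integral of `f` (the translates `[0,L)³ − Lε` tile `[−L,L)³ ⊇ supp f`):
`∑_ε ∫_{[0,L)³} f(x − Lε) dx = ∫_{ℝ³} f`.  This is the device by which compactly supported kernels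
on `ℝ³` are read as functions on the torus `ℝ³/Lℤ³` in the proof of `IMUChainGlue`.
-/

noncomputable section

open MeasureTheory Set
open scoped ENNReal

namespace Summit.AtomisticToContinuum.BoseEinsteinCondensation.Theorems.IMUChainGlue

open Literature.MathematicalPhysics.QuantumManyBody.BoseGas

/-- The eight corners `{0,1}³ ⊂ ℤ³` of the unit cube (a `Finset (Fin 3 → ℤ)`; local notation,
so that `latticeVec L ε`, `ε ∈ corners`, are the corners `Lε` of the cell). -/
local notation "corners" => (Fintype.piFinset fun _ : Fin 3 => ({0, 1} : Finset ℤ))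

/-- Membership in `corners`: every coordinate is `0` or `1`. -/
theorem mem_corners {ε : Fin 3 → ℤ} : ε ∈ corners ↔ ∀ k, ε k = 0 ∨ ε k = 1 := by
  simp [Fintype.mem_piFinset]

/-- `corners` has eight elements. -/
theorem card_corners : Finset.card corners = 8 := by
  rw [Fintype.card_piFinset]
  norm_num

/-- Coordinates of a lattice vector: `(L·ε)_k = L ε_k`. -/
theorem latticeVec_apply (L : ℝ) (ε : Fin 3 → ℤ) (k : Fin 3) :
    latticeVec L ε k = L * (ε k : ℝ) := by
  simp [latticeVec]

/-- **The corner of a point of `(−L,L)³`**: there is exactly one corner `ε₀ ∈ {0,1}³` with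
`y + Lε₀ ∈ [0,L)³` (namely `ε₀_k = 1` exactly where `y_k < 0`). -/
theorem existsUnique_corner {L : ℝ} {y : Space} (hy : ∀ k, |y k| < L) :
    ∃ ε₀ ∈ corners, y + latticeVec L ε₀ ∈ cell L ∧
      ∀ ε ∈ corners, ε ≠ ε₀ → y + latticeVec L ε ∉ cell L := by
  refine ⟨fun k => if y k < 0 then 1 else 0, ?_, ?_, ?_⟩
  · rw [mem_corners]
    intro k
    by_cases h : y k < 0 <;> simp [h]
  · intro k
    have hk := abs_lt.1 (hy k)
    simp only [PiLp.add_apply, latticeVec_apply]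
    by_cases h : y k < 0
    · simp only [h, ↓reduceIte, Int.cast_one, mul_one, mem_Ico]
      constructor <;> linarith [hk.1]
    · simp only [h, ↓reduceIte, Int.cast_zero, mul_zero, add_zero, mem_Ico]
      exact ⟨not_lt.1 h, hk.2⟩
  · intro ε hε hne hmem
    apply hne
    funext k
    have hk := hmem k
    simp only [PiLp.add_apply, latticeVec_apply, mem_Ico] at hk
    rcases (mem_corners.1 hε) k with h0 | h1
    · -- `ε_k = 0`: then `0 ≤ y_k`, so the corner coordinate is `0`
      rw [h0, Int.cast_zero, mul_zero, add_zero] at hk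
      rw [h0, if_neg (not_lt.2 hk.1)]
    · -- `ε_k = 1`: then `y_k < 0`
      rw [h1, Int.cast_one, mul_one] at hk
      have : y k < 0 := by linarith [hk.2]
      rw [h1, if_pos this]

/-- **The corner decomposition, pointwise**: for a function vanishing outside the ball of radius
`b ≤ L`, `∑_ε 1_{cell}(y + Lε) f(y) = f(y)`. -/
theorem sum_corners_indicator_eq {E : Type*} [AddCommMonoid E] {L b : ℝ}
    (hb : b ≤ L) {f : Space → E} (hf0 : ∀ x, b ≤ ‖x‖ → f x = 0) (y : Space) :
    ∑ ε ∈ corners, ((fun x : Space => x + latticeVec L ε) ⁻¹' cell L).indicator f y = f y := by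
  by_cases hfy : f y = 0
  · rw [hfy]
    refine Finset.sum_eq_zero fun ε _ => ?_
    by_cases hmem : y ∈ (fun x : Space => x + latticeVec L ε) ⁻¹' cell L
    · rw [indicator_of_mem hmem, hfy]
    · rw [indicator_of_notMem hmem]
  · have hy : ‖y‖ < b := lt_of_not_ge fun h => hfy (hf0 y h)
    have hyk : ∀ k, |y k| < L := fun k =>
      lt_of_le_of_lt (by simpa using PiLp.norm_apply_le y k) (lt_of_lt_of_le hy hb)
    obtain ⟨ε₀, hε₀, hmem, huniq⟩ := existsUnique_corner hyk
    rw [Finset.sum_eq_single ε₀]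
    · rw [indicator_of_mem]
      exact hmem
    · intro ε hε hne
      rw [indicator_of_notMem]
      exact huniq ε hε hne
    · intro h
      exact absurd hε₀ h

/-- Cell integral of a translate as a whole-space integral against a translated cell. -/
theorem setIntegral_cell_comp_sub {E : Type*} [NormedAddCommGroup E] [NormedSpace ℝ E] (L : ℝ)
    (f : Space → E) (c : Space) :
    ∫ x in cell L, f (x - c) = ∫ y, ((fun x : Space => x + c) ⁻¹' cell L).indicator f y := by
  rw [← integral_indicator (measurableSet_cell L)]
  have h : (fun x => (cell L).indicator (fun x => f (x - c)) x) =
      fun x => ((fun x : Space => x + c) ⁻¹' cell L).indicator f (x - c) := by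
    funext x
    by_cases hx : x ∈ cell L
    · rw [indicator_of_mem hx, indicator_of_mem]
      simpa using hx
    · rw [indicator_of_notMem hx, indicator_of_notMem]
      simpa using hx
  rw [h]
  exact integral_sub_right_eq_self _ c

/-- **The eight corners of the cell tile a neighbourhood of the origin.** For `f` integrable on
`ℝ³` and vanishing outside the ball `‖x‖ < b`, `b ≤ L`:
`∑_{ε ∈ {0,1}³} ∫_{[0,L)³} f(x − Lε) dx = ∫_{ℝ³} f`. -/
theorem sum_corners_setIntegral_cell_sub {E : Type*} [NormedAddCommGroup E] [NormedSpace ℝ E]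
    {L b : ℝ} (hb : b ≤ L) {f : Space → E} (hf0 : ∀ x, b ≤ ‖x‖ → f x = 0)
    (hfi : Integrable f) :
    ∑ ε ∈ corners, ∫ x in cell L, f (x - latticeVec L ε) = ∫ x, f x := by
  simp only [setIntegral_cell_comp_sub]
  rw [← integral_finsetSum]
  · exact integral_congr_ae (Filter.Eventually.of_forall fun y =>
      sum_corners_indicator_eq hb hf0 y)
  · intro ε _
    exact hfi.indicator ((measurableSet_cell L).preimage (measurable_id.add_const _))

end Summit.AtomisticToContinuum.BoseEinsteinCondensation.Theorems.IMUChainGlue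

end
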